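import Literature.AlgebraicGeometry.Resolution.RankOneDensity
import Literature.AlgebraicGeometry.Resolution.ImmediateRationalUniformization
import Literature.AlgebraicGeometry.Resolution.GeneralizedStabilityHenselizedRational
import Literature.AlgebraicGeometry.Resolution.NormalDegreePDefectlessArtinSchreier
import Mathlib.Algebra.Polynomial.Lifts
import Mathlib.FieldTheory.Perfect
import HarnessLib

/-!
# Polynomial tools for Kummer radicands: coefficient bounds, `(1 + ∑ eₖYᵏ)^p`, geometric inverses (Kuhlmann 2019, Lemma 4.3, proof)

Topic: `Literature/AlgebraicGeometry/Resolution` (valued function fields). PROVED bookkeeping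
for the mixed-characteristic normal form of F.-V. Kuhlmann, *Elimination of ramification II:
Henselian rationality*, Israel J. Math. 234 (2019) = arXiv:1701.05508, Lemma 4.3 (proof,
p. 9 of the arXiv text):

> For every `i` divisible by `p`, we choose `d_i^{1/p}` to be any `p`-th root of `d_i` in `K`
> … We choose a polynomial `s(y) ∈ K[y]` such that
> `s(y) ≡ (1 + ∑_{p|i} d_i^{1/p} y^{i/p})^{-1} mod p𝓜_K[y]`; this can be done using the
> geometrical series of the right hand side together with our assumption that the rank of
> `(K,v)` is 1. Note that `vs(y) = 0` and the constant term of `s(y)` as a polynomial in `y` is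
> a `1`-unit … We have that `s(y)^p ≡ (1 + ∑_{p|i} d_i^{1/p} y^{i/p})^{-p} mod p²𝓜_K[y]` and
> `s(y)^p(1+f(x)) = s(y)^p[(1+∑_{p|i} d_i^{1/p}y^{i/p})^p + f̃(y) + ∑_{p∤i} d_iy^i]` with
> `f̃(y) ∈ p𝓜_K[y]`.

All statements concern polynomials over the ambient valued field `(Ω, V)` with coefficients in a
subfield `K ≤ Ω`; "`P ∈ 𝓜^α_K[Y]`" is rendered by coefficient bounds `∀ n, v(P_n) ≤ α`
(resp. `< α`), values multiplicative.

## Content (everything PROVED; no definition, no named fact)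

* closure of "coefficients in `K`" under ring operations (`forall_coeff_mul_mem`, `…_pow_mem`,
  `…_sum_mem`, …) via Mathlib's `Polynomial.lifts`;
* ultrametric coefficient bounds for sums, products, powers, Hasse–Schmidt derivatives, Taylor
  coefficients and values (`valuation_coeff_mul_le`, `valuation_coeff_pow_le`,
  `valuation_eval_le_of_coeff_le`, …);
* `exists_one_add_sum_pow_eq_add` — `(1 + ∑_{k∈S} e_k Y^k)^p = 1 + ∑_{k∈S} e_k^p Y^{kp} + F̃`
  with `v(F̃_n) < v(p)` for all `n`, when `v(e_k) < 1` ("`f̃(y) ∈ p𝓜_K[y]`");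
* `exists_geometric_inverse` — for `U` over `K` with coefficients of value `≤ v(t) < 1`,
  `t ∈ K`, `(K, v)` of rank one, and `0 ≠ β`, a polynomial `s = ∑_{n ≤ M} (−U)^n` over `K` with
  `s·(1 + U) = 1 + R`, `v(R_n) < β`, `v(s_n) ≤ 1`, `s_0` a `1`-unit and `v(s_n) < 1` for
  `n ≥ 1` when `v(U_n) < 1` for all `n` (the printed `s(y)`).

## Sources

* [K19] F.-V. Kuhlmann, Israel J. Math. 234 (2019) = arXiv:1701.05508: Lemma 4.3 (proof).
  [Kuhlmann2019]
-/

noncomputable section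

open IsLocalRing Polynomial Finset

namespace Literature.AlgebraicGeometry.Resolution

universe u

variable {Ω : Type u} [Field Ω] (V : ValuationSubring Ω)

/-! ### Coefficients in a subfield -/

section CoeffMem

variable (K : Subfield Ω)

/-- "All coefficients in `K`" is membership in `Polynomial.lifts K.subtype`. [folklore] -/
theorem forall_coeff_mem_iff_mem_lifts (P : Polynomial Ω) :
    (∀ n, P.coeff n ∈ K) ↔ P ∈ Polynomial.lifts K.subtype := by
  rw [Polynomial.lifts_iff_coeff_lifts]
  refine forall_congr' fun n => ?_
  constructor
  · intro h; exact ⟨⟨P.coeff n, h⟩, rfl⟩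
  · rintro ⟨x, hx⟩; rw [← hx]; exact x.2

variable {K}

/-- Products of polynomials over `K` are over `K`. [folklore] -/
theorem forall_coeff_mul_mem {P Q : Polynomial Ω} (hP : ∀ n, P.coeff n ∈ K)
    (hQ : ∀ n, Q.coeff n ∈ K) : ∀ n, (P * Q).coeff n ∈ K :=
  (forall_coeff_mem_iff_mem_lifts K _).mpr (Subsemiring.mul_mem _
    ((forall_coeff_mem_iff_mem_lifts K P).mp hP) ((forall_coeff_mem_iff_mem_lifts K Q).mp hQ))

/-- Powers of polynomials over `K` are over `K`. [folklore] -/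
theorem forall_coeff_pow_mem {P : Polynomial Ω} (hP : ∀ n, P.coeff n ∈ K) (m : ℕ) :
    ∀ n, (P ^ m).coeff n ∈ K :=
  (forall_coeff_mem_iff_mem_lifts K _).mpr (Subsemiring.pow_mem _
    ((forall_coeff_mem_iff_mem_lifts K P).mp hP) m)

/-- Sums of polynomials over `K` are over `K`. [folklore] -/
theorem forall_coeff_add_mem {P Q : Polynomial Ω} (hP : ∀ n, P.coeff n ∈ K)
    (hQ : ∀ n, Q.coeff n ∈ K) : ∀ n, (P + Q).coeff n ∈ K := fun n => by
  rw [coeff_add]; exact add_mem (hP n) (hQ n)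

/-- Negatives of polynomials over `K` are over `K`. [folklore] -/
theorem forall_coeff_neg_mem {P : Polynomial Ω} (hP : ∀ n, P.coeff n ∈ K) :
    ∀ n, (-P).coeff n ∈ K := fun n => by rw [coeff_neg]; exact neg_mem (hP n)

/-- Differences of polynomials over `K` are over `K`. [folklore] -/
theorem forall_coeff_sub_mem {P Q : Polynomial Ω} (hP : ∀ n, P.coeff n ∈ K)
    (hQ : ∀ n, Q.coeff n ∈ K) : ∀ n, (P - Q).coeff n ∈ K := fun n => by
  rw [coeff_sub]; exact sub_mem (hP n) (hQ n)

/-- Finite sums of polynomials over `K` are over `K`. [folklore] -/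
theorem forall_coeff_sum_mem {ι : Type*} (s : Finset ι) {P : ι → Polynomial Ω}
    (hP : ∀ i ∈ s, ∀ n, (P i).coeff n ∈ K) : ∀ n, (∑ i ∈ s, P i).coeff n ∈ K := fun n => by
  rw [finsetSum_coeff]; exact sum_mem fun i hi => hP i hi n

/-- Constants from `K` are over `K`. [folklore] -/
theorem forall_coeff_C_mem {a : Ω} (ha : a ∈ K) : ∀ n, (C a).coeff n ∈ K := fun n => by
  rw [coeff_C]; split_ifs <;> simp [ha, K.zero_mem]

/-- `X^k` is over `K`. [folklore] -/
theorem forall_coeff_X_pow_mem (k : ℕ) : ∀ n, ((X : Polynomial Ω) ^ k).coeff n ∈ K := fun n => by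
  rw [coeff_X_pow]; split_ifs <;> simp [K.one_mem, K.zero_mem]

/-- Monomials with coefficient in `K` are over `K`. [folklore] -/
theorem forall_coeff_C_mul_X_pow_mem {a : Ω} (ha : a ∈ K) (k : ℕ) :
    ∀ n, (C a * X ^ k).coeff n ∈ K := fun n => by
  rw [coeff_C_mul_X_pow]; split_ifs <;> simp [ha, K.zero_mem]

/-- `1` is over `K`. [folklore] -/
theorem forall_coeff_one_mem : ∀ n, (1 : Polynomial Ω).coeff n ∈ K := fun n => by
  rw [coeff_one]; split_ifs <;> simp [K.one_mem, K.zero_mem]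

end CoeffMem

/-! ### Ultrametric coefficient bounds -/

section Bounds

/-- Coefficient bound for a sum. [folklore] -/
theorem valuation_coeff_add_le {P Q : Polynomial Ω} {α : V.ValueGroup}
    (hP : ∀ n, V.valuation (P.coeff n) ≤ α) (hQ : ∀ n, V.valuation (Q.coeff n) ≤ α) (n : ℕ) :
    V.valuation ((P + Q).coeff n) ≤ α := by
  rw [coeff_add]; exact Valuation.map_add_le _ (hP n) (hQ n)

/-- Strict coefficient bound for a sum. [folklore] -/
theorem valuation_coeff_add_lt {P Q : Polynomial Ω} {α : V.ValueGroup}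
    (hP : ∀ n, V.valuation (P.coeff n) < α) (hQ : ∀ n, V.valuation (Q.coeff n) < α) (n : ℕ) :
    V.valuation ((P + Q).coeff n) < α := by
  rw [coeff_add]; exact Valuation.map_add_lt _ (hP n) (hQ n)

/-- Strict coefficient bound for a difference. [folklore] -/
theorem valuation_coeff_sub_lt {P Q : Polynomial Ω} {α : V.ValueGroup}
    (hP : ∀ n, V.valuation (P.coeff n) < α) (hQ : ∀ n, V.valuation (Q.coeff n) < α) (n : ℕ) :
    V.valuation ((P - Q).coeff n) < α := by
  rw [coeff_sub]; exact Valuation.map_sub_lt _ (hP n) (hQ n)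

/-- Coefficients of `-P` have the same values. [folklore] -/
theorem valuation_coeff_neg {P : Polynomial Ω} (n : ℕ) :
    V.valuation ((-P).coeff n) = V.valuation (P.coeff n) := by
  rw [coeff_neg, Valuation.map_neg]

/-- Coefficient bound for a finite sum. [folklore] -/
theorem valuation_coeff_sum_le {ι : Type*} (s : Finset ι) {P : ι → Polynomial Ω} {α : V.ValueGroup}
    (hP : ∀ i ∈ s, ∀ n, V.valuation ((P i).coeff n) ≤ α) (n : ℕ) :
    V.valuation ((∑ i ∈ s, P i).coeff n) ≤ α := by
  rw [finsetSum_coeff]; exact Valuation.map_sum_le _ fun i hi => hP i hi n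

/-- Strict coefficient bound for a finite sum. [folklore] -/
theorem valuation_coeff_sum_lt {ι : Type*} (s : Finset ι) {P : ι → Polynomial Ω} {α : V.ValueGroup}
    (hα : α ≠ 0) (hP : ∀ i ∈ s, ∀ n, V.valuation ((P i).coeff n) < α) (n : ℕ) :
    V.valuation ((∑ i ∈ s, P i).coeff n) < α := by
  rw [finsetSum_coeff]; exact Valuation.map_sum_lt _ hα fun i hi => hP i hi n

/-- Coefficients of a product are bounded by the product of the bounds. [folklore] -/
theorem valuation_coeff_mul_le {P Q : Polynomial Ω} {α β : V.ValueGroup}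
    (hP : ∀ n, V.valuation (P.coeff n) ≤ α) (hQ : ∀ n, V.valuation (Q.coeff n) ≤ β) (n : ℕ) :
    V.valuation ((P * Q).coeff n) ≤ α * β := by
  rw [coeff_mul]
  refine Valuation.map_sum_le _ fun x _ => ?_
  rw [map_mul]; exact mul_le_mul' (hP x.1) (hQ x.2)

/-- Strict version: `v(P_n) < α`, `v(Q_n) ≤ β`, `0 < β` give `v((PQ)_n) < αβ`. [folklore] -/
theorem valuation_coeff_mul_lt {P Q : Polynomial Ω} {α β : V.ValueGroup}
    (hP : ∀ n, V.valuation (P.coeff n) < α) (hQ : ∀ n, V.valuation (Q.coeff n) ≤ β) (hβ : 0 < β)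
    (n : ℕ) : V.valuation ((P * Q).coeff n) < α * β := by
  have hα : 0 < α := lt_of_le_of_lt zero_le (hP 0)
  rw [coeff_mul]
  refine Valuation.map_sum_lt _ (mul_pos hα hβ).ne' fun x _ => ?_
  rw [map_mul]
  rcases eq_or_ne (V.valuation (Q.coeff x.2)) 0 with h0 | h0
  · rw [h0, mul_zero]; exact mul_pos hα hβ
  · calc V.valuation (P.coeff x.1) * V.valuation (Q.coeff x.2)
        < α * V.valuation (Q.coeff x.2) := mul_lt_mul_of_pos_right (hP x.1) (zero_lt_iff.mpr h0)
      _ ≤ α * β := mul_le_mul' le_rfl (hQ x.2)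

/-- The same with the strict bound on the second factor. [folklore] -/
theorem valuation_coeff_mul_lt' {P Q : Polynomial Ω} {α β : V.ValueGroup}
    (hP : ∀ n, V.valuation (P.coeff n) ≤ α) (hQ : ∀ n, V.valuation (Q.coeff n) < β) (hα : 0 < α)
    (n : ℕ) : V.valuation ((P * Q).coeff n) < α * β := by
  rw [mul_comm P Q, mul_comm α β]; exact valuation_coeff_mul_lt V hQ hP hα n

/-- Coefficients of `1` have value `≤ 1`. [folklore] -/
theorem valuation_coeff_one_le (n : ℕ) : V.valuation ((1 : Polynomial Ω).coeff n) ≤ 1 := by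
  rw [coeff_one]; split_ifs <;> simp

/-- Coefficients of a power. [folklore] -/
theorem valuation_coeff_pow_le {P : Polynomial Ω} {α : V.ValueGroup}
    (hP : ∀ n, V.valuation (P.coeff n) ≤ α) (m : ℕ) (n : ℕ) :
    V.valuation ((P ^ m).coeff n) ≤ α ^ m := by
  induction m generalizing n with
  | zero => rw [pow_zero, pow_zero]; exact valuation_coeff_one_le V n
  | succ m ih => rw [pow_succ, pow_succ]; exact valuation_coeff_mul_le V ih hP n

/-- Coefficient bound for `C a * P`. [folklore] -/
theorem valuation_coeff_C_mul_le {P : Polynomial Ω} {α : V.ValueGroup}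
    (hP : ∀ n, V.valuation (P.coeff n) ≤ α) (a : Ω) (n : ℕ) :
    V.valuation ((C a * P).coeff n) ≤ V.valuation a * α := by
  rw [coeff_C_mul, map_mul]; exact mul_le_mul' le_rfl (hP n)

/-- Strict coefficient bound for `C a * P`. [folklore] -/
theorem valuation_coeff_C_mul_lt {P : Polynomial Ω} {α : V.ValueGroup}
    (hP : ∀ n, V.valuation (P.coeff n) < α) {a : Ω} (ha : a ≠ 0) (n : ℕ) :
    V.valuation ((C a * P).coeff n) < V.valuation a * α := by
  rw [coeff_C_mul, map_mul]; exact mul_lt_mul_of_pos_left (hP n) ((Valuation.pos_iff _).mpr ha)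

/-- Coefficients of a monomial `a X^k` have value `≤ v(a)`. [folklore] -/
theorem valuation_coeff_C_mul_X_pow (a : Ω) (k n : ℕ) :
    V.valuation ((C a * X ^ k).coeff n) ≤ V.valuation a := by
  rw [coeff_C_mul_X_pow]; split_ifs <;> simp

/-- Natural numbers have value `≤ 1`. [folklore] -/
theorem valuation_natCast_le_one (m : ℕ) : V.valuation ((m : ℕ) : Ω) ≤ 1 :=
  (V.valuation_le_one_iff _).mpr (natCast_mem V m)

/-- Value of a polynomial with bounded coefficients at an integral point. [folklore] -/
theorem valuation_eval_le_of_coeff_le {P : Polynomial Ω} {α : V.ValueGroup}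
    (hP : ∀ n, V.valuation (P.coeff n) ≤ α) {x : Ω} (hx : V.valuation x ≤ 1) :
    V.valuation (P.eval x) ≤ α := by
  rw [eval_eq_sum_range]
  refine Valuation.map_sum_le _ fun n _ => ?_
  rw [map_mul, map_pow]
  calc V.valuation (P.coeff n) * V.valuation x ^ n ≤ α * 1 :=
        mul_le_mul' (hP n) (pow_le_one₀ zero_le hx)
    _ = α := mul_one α

/-- Strict version. [folklore] -/
theorem valuation_eval_lt_of_coeff_lt {P : Polynomial Ω} {α : V.ValueGroup}
    (hP : ∀ n, V.valuation (P.coeff n) < α) {x : Ω} (hx : V.valuation x ≤ 1) :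
    V.valuation (P.eval x) < α := by
  have hα : α ≠ 0 := (lt_of_le_of_lt zero_le (hP 0)).ne'
  rw [eval_eq_sum_range]
  refine Valuation.map_sum_lt _ hα fun n _ => ?_
  rw [map_mul, map_pow]
  calc V.valuation (P.coeff n) * V.valuation x ^ n ≤ V.valuation (P.coeff n) * 1 :=
        mul_le_mul' le_rfl (pow_le_one₀ zero_le hx)
    _ < α := by rw [mul_one]; exact hP n

/-- Hasse–Schmidt derivatives do not increase coefficient bounds. [folklore] -/
theorem valuation_hasseDeriv_coeff_le {P : Polynomial Ω} {α : V.ValueGroup}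
    (hP : ∀ n, V.valuation (P.coeff n) ≤ α) (k n : ℕ) :
    V.valuation ((hasseDeriv k P).coeff n) ≤ α := by
  rw [hasseDeriv_coeff, map_mul]
  calc V.valuation (((n + k).choose k : ℕ) : Ω) * V.valuation (P.coeff (n + k)) ≤ 1 * α :=
        mul_le_mul' (valuation_natCast_le_one V _) (hP _)
    _ = α := one_mul α

/-- Strict version of `valuation_hasseDeriv_coeff_le`. [folklore] -/
theorem valuation_hasseDeriv_coeff_lt {P : Polynomial Ω} {α : V.ValueGroup}
    (hP : ∀ n, V.valuation (P.coeff n) < α) (k n : ℕ) :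
    V.valuation ((hasseDeriv k P).coeff n) < α := by
  rw [hasseDeriv_coeff, map_mul]
  calc V.valuation (((n + k).choose k : ℕ) : Ω) * V.valuation (P.coeff (n + k))
      ≤ 1 * V.valuation (P.coeff (n + k)) := mul_le_mul' (valuation_natCast_le_one V _) le_rfl
    _ < α := by rw [one_mul]; exact hP _

/-- Taylor coefficients at an integral centre. [folklore] -/
theorem valuation_taylor_coeff_le {P : Polynomial Ω} {α : V.ValueGroup}
    (hP : ∀ n, V.valuation (P.coeff n) ≤ α) {c : Ω} (hc : V.valuation c ≤ 1) (k : ℕ) :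
    V.valuation ((taylor c P).coeff k) ≤ α := by
  rw [taylor_coeff]; exact valuation_eval_le_of_coeff_le V (valuation_hasseDeriv_coeff_le V hP k) hc

/-- Strict version of `valuation_taylor_coeff_le`. [folklore] -/
theorem valuation_taylor_coeff_lt {P : Polynomial Ω} {α : V.ValueGroup}
    (hP : ∀ n, V.valuation (P.coeff n) < α) {c : Ω} (hc : V.valuation c ≤ 1) (k : ℕ) :
    V.valuation ((taylor c P).coeff k) < α := by
  rw [taylor_coeff]; exact valuation_eval_lt_of_coeff_lt V (valuation_hasseDeriv_coeff_lt V hP k) hc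

end Bounds

/-! ### `(1 + ∑ e_k Y^k)^p = 1 + ∑ e_k^p Y^{kp} + (coefficients of value < v(p))` -/

/-- **"`f̃(y) ∈ p𝓜_K[y]`"** (Kuhlmann 2019, proof of Lemma 4.3): for a prime `p`, a finite set
of exponents `S` and elements `e_k ∈ K` of value `< 1`,
`(1 + ∑_{k∈S} e_k Y^k)^p = 1 + ∑_{k∈S} e_k^p Y^{kp} + F̃` with `F̃` over `K` all of whose
coefficients have value `< v(p)`. PROVED by induction on `S` from Mathlib's `add_pow_prime_eq`.
[cite: Kuhlmann2019, Lemma 4.3 (proof)] -/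
theorem exists_one_add_sum_pow_eq_add (K : Subfield Ω) {p : ℕ} (hp : p.Prime) (hp0 : (p : Ω) ≠ 0)
    (S : Finset ℕ) {e : ℕ → Ω} (heK : ∀ k ∈ S, e k ∈ K) (he : ∀ k ∈ S, V.valuation (e k) < 1) :
    ∃ F : Polynomial Ω, (∀ n, F.coeff n ∈ K) ∧ (∀ n, V.valuation (F.coeff n) < V.valuation (p : Ω)) ∧
      (1 + ∑ k ∈ S, C (e k) * X ^ k) ^ p = 1 + ∑ k ∈ S, C (e k ^ p) * X ^ (k * p) + F := by
  classical
  have hvp : 0 < V.valuation (p : Ω) := (Valuation.pos_iff _).mpr hp0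
  induction S using Finset.induction_on with
  | empty =>
    refine ⟨0, fun n => by simp [K.zero_mem], fun n => by simpa using hvp, by simp⟩
  | insert i S hi ih =>
    obtain ⟨F, hFK, hFv, hFeq⟩ := ih (fun k hk => heK k (mem_insert_of_mem hk))
      (fun k hk => he k (mem_insert_of_mem hk))
    have heiK : e i ∈ K := heK i (mem_insert_self i S)
    have hei : V.valuation (e i) < 1 := he i (mem_insert_self i S)
    set A : Polynomial Ω := 1 + ∑ k ∈ S, C (e k) * X ^ k with hA
    set B : Polynomial Ω := C (e i) * X ^ i with hB
    have hAK : ∀ n, A.coeff n ∈ K := forall_coeff_add_mem forall_coeff_one_mem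
      (forall_coeff_sum_mem S fun k hk => forall_coeff_C_mul_X_pow_mem (heK k (mem_insert_of_mem hk)) k)
    have hBK : ∀ n, B.coeff n ∈ K := forall_coeff_C_mul_X_pow_mem heiK i
    have hA1 : ∀ n, V.valuation (A.coeff n) ≤ 1 := valuation_coeff_add_le V (valuation_coeff_one_le V)
      (valuation_coeff_sum_le V S fun k hk n =>
        (valuation_coeff_C_mul_X_pow V _ _ _).trans (he k (mem_insert_of_mem hk)).le)
    have hB1 : ∀ n, V.valuation (B.coeff n) < 1 := fun n => by
      rw [hB, coeff_C_mul_X_pow]; split_ifs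
      · exact hei
      · rw [map_zero]; exact zero_lt_one
    -- the binomial expansion `(A + B)^p = A^p + B^p + p A B T`
    set T : Polynomial Ω := ∑ k ∈ Ioo 0 p, A ^ (k - 1) * B ^ (p - k - 1) * ((p.choose k / p : ℕ) : Polynomial Ω)
      with hT
    have hexp : (A + B) ^ p = A ^ p + B ^ p + p * A * B * T := add_pow_prime_eq hp A B
    have hTK : ∀ n, T.coeff n ∈ K := forall_coeff_sum_mem _ fun k _ =>
      forall_coeff_mul_mem (forall_coeff_mul_mem (forall_coeff_pow_mem hAK _) (forall_coeff_pow_mem hBK _))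
        (fun n => by rw [← C_eq_natCast, coeff_C]; split_ifs <;> simp [natCast_mem K, K.zero_mem])
    have hT1 : ∀ n, V.valuation (T.coeff n) ≤ 1 := by
      refine valuation_coeff_sum_le V _ fun k _ n => ?_
      have h1 : ∀ n, V.valuation ((A ^ (k - 1) * B ^ (p - k - 1)).coeff n) ≤ 1 := fun n => by
        have := valuation_coeff_mul_le V (valuation_coeff_pow_le V hA1 (k - 1))
          (valuation_coeff_pow_le V (fun n => (hB1 n).le) (p - k - 1)) n
        simpa using this
      have h2 : ∀ n, V.valuation (((p.choose k / p : ℕ) : Polynomial Ω).coeff n) ≤ 1 := fun n => by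
        rw [← C_eq_natCast, coeff_C]; split_ifs
        · exact valuation_natCast_le_one V _
        · rw [map_zero]; exact zero_le
      simpa using valuation_coeff_mul_le V h1 h2 n
    -- the new error term `p A B T` has coefficients `< v(p)`
    set E : Polynomial Ω := (p : Polynomial Ω) * A * B * T with hE
    have hEK : ∀ n, E.coeff n ∈ K := forall_coeff_mul_mem (forall_coeff_mul_mem (forall_coeff_mul_mem
      (fun n => by rw [← C_eq_natCast, coeff_C]; split_ifs <;> simp [natCast_mem K, K.zero_mem]) hAK) hBK) hTK
    have hEv : ∀ n, V.valuation (E.coeff n) < V.valuation (p : Ω) := by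
      intro n
      have hpA : ∀ n, V.valuation (((p : Polynomial Ω) * A).coeff n) ≤ V.valuation (p : Ω) := fun n => by
        rw [← C_eq_natCast]; simpa using valuation_coeff_C_mul_le V hA1 (p : Ω) n
      have hpAB : ∀ n, V.valuation (((p : Polynomial Ω) * A * B).coeff n) < V.valuation (p : Ω) * 1 :=
        valuation_coeff_mul_lt' V hpA hB1 hvp
      have := valuation_coeff_mul_lt V hpAB hT1 zero_lt_one n
      simpa using this
    refine ⟨F + E, forall_coeff_add_mem hFK hEK, valuation_coeff_add_lt V hFv hEv, ?_⟩
    rw [sum_insert hi, sum_insert hi, show (1 : Polynomial Ω) + (C (e i) * X ^ i + ∑ k ∈ S, C (e k) * X ^ k)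
      = A + B by rw [hA, hB]; ring, hexp, hFeq, hB, mul_pow, ← C_pow, ← pow_mul]
    ring

/-! ### The geometric inverse `s(y) = ∑_{n ≤ M} (−U)^n` -/

/-- **The polynomial `s(y)`** (Kuhlmann 2019, proof of Lemma 4.3: "We choose a polynomial
`s(y) ∈ K[y]` such that `s(y) ≡ (1 + ∑_{p|i} d_i^{1/p} y^{i/p})^{-1} mod p𝓜_K[y]`; this can be
done using the geometrical series of the right hand side together with our assumption that
the rank of `(K,v)` is 1. Note that … the constant term of `s(y)` … is a `1`-unit"): for
`U` over a rank-one `K` with coefficients of value `≤ v(t) < 1`, `t ∈ K`, and `0 ≠ η ∈ K`, the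
polynomial `s = ∑_{n ≤ M} (−U)^n` (for `M` with `v(t)^{M+1} < v(η)`) is over `K`, has
coefficients of value `≤ 1`, those of positive degree of value `≤ v(t)`, `s_0 ≡ 1` modulo
value `≤ v(t)`, and `s·(1 + U) = 1 − (−U)^{M+1}` with `v(((−U)^{M+1})_n) < v(η)`.
[cite: Kuhlmann2019, Lemma 4.3 (proof)] -/
theorem exists_geometric_inverse {K : Subfield Ω} (hr1 : IsRankOneValued V K) {U : Polynomial Ω}
    (hUK : ∀ n, U.coeff n ∈ K) {t : Ω} (htK : t ∈ K) (ht0 : t ≠ 0) (ht1 : V.valuation t < 1)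
    (hU : ∀ n, V.valuation (U.coeff n) ≤ V.valuation t) {η : Ω} (hηK : η ∈ K) (hη0 : η ≠ 0) :
    ∃ s : Polynomial Ω, (∀ n, s.coeff n ∈ K) ∧ (∀ n, V.valuation (s.coeff n) ≤ 1) ∧
      (∀ n, 1 ≤ n → V.valuation (s.coeff n) ≤ V.valuation t) ∧
      V.valuation (s.coeff 0 - 1) ≤ V.valuation t ∧
      ∀ n, V.valuation ((s * (1 + U) - 1).coeff n) < V.valuation η := by
  classical
  obtain ⟨M, hM⟩ := hr1.exists_pow_lt htK ht0 ht1 hηK hη0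
  set s : Polynomial Ω := ∑ k ∈ range (M + 1), (-U) ^ k with hs
  have hnegU : ∀ n, V.valuation ((-U).coeff n) ≤ V.valuation t := fun n => by
    rw [valuation_coeff_neg]; exact hU n
  have hpowk : ∀ k n, V.valuation (((-U) ^ k).coeff n) ≤ V.valuation t ^ k := fun k n =>
    valuation_coeff_pow_le V hnegU k n
  have ht1' : ∀ k, V.valuation t ^ k ≤ 1 := fun k => pow_le_one₀ zero_le ht1.le
  have htk : ∀ k, 1 ≤ k → V.valuation t ^ k ≤ V.valuation t := fun k hk => by
    calc V.valuation t ^ k = V.valuation t ^ (k - 1) * V.valuation t := by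
          rw [← pow_succ, Nat.sub_add_cancel hk]
      _ ≤ 1 * V.valuation t := mul_le_mul' (ht1' _) le_rfl
      _ = V.valuation t := one_mul _
  refine ⟨s, ?_, ?_, ?_, ?_, ?_⟩
  · exact forall_coeff_sum_mem _ fun k _ => forall_coeff_pow_mem (forall_coeff_neg_mem hUK) k
  · exact valuation_coeff_sum_le V _ fun k _ n => (hpowk k n).trans (ht1' k)
  · intro n hn
    rw [hs, finsetSum_coeff, ← Finset.add_sum_erase _ _ (mem_range.mpr (Nat.succ_pos M)), pow_zero,
      coeff_one, if_neg (by omega), zero_add]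
    refine Valuation.map_sum_le _ fun k hk => ?_
    rw [mem_erase] at hk
    exact (hpowk k n).trans (htk k (Nat.one_le_iff_ne_zero.mpr hk.1))
  · rw [hs, finsetSum_coeff, ← Finset.add_sum_erase _ _ (mem_range.mpr (Nat.succ_pos M)), pow_zero,
      coeff_one, if_pos rfl, add_sub_cancel_left]
    refine Valuation.map_sum_le _ fun k hk => ?_
    rw [mem_erase] at hk
    exact (hpowk k 0).trans (htk k (Nat.one_le_iff_ne_zero.mpr hk.1))
  · intro n
    have hgeom : s * (1 + U) - 1 = -((-U) ^ (M + 1)) := by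
      rw [hs, show (1 + U : Polynomial Ω) = 1 - (-U) by ring, geom_sum_mul_neg]
      ring
    rw [hgeom, valuation_coeff_neg]
    exact (hpowk (M + 1) n).trans_lt hM

end Literature.AlgebraicGeometry.Resolution

end
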